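import Mathlib
import HarnessLib
import Summits.CriticalPhenomena.Ising3DConformalLimit.Theses.MirrorHoelderCompactness
import Summits.CriticalPhenomena.Ising3DConformalLimit.Theses.MonotoneBlocking
import Summits.CriticalPhenomena.Ising3DConformalLimit.Theorems.HyperoctahedralRPExistsScaleCovariantLimitNonSeparableModulusOfUniformRegularity
import Summits.CriticalPhenomena.Ising3DConformalLimit.Theorems.HyperoctahedralRPExistsScaleCovariantLimitCompactnessItemMapsDoubling
import Literature.Probability.LatticeModels.CriticalAxisRatioRegularity
import Literature.Probability.LatticeModels.PointwiseScalingLimitEtaExists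
import Literature.Probability.LatticeModels.CriticalUrsellFourSign
import Literature.Probability.LatticeModels.HighDimPointwiseTriviality
import Summits.CriticalPhenomena.Ising3DConformalLimit.Theorems.GapForcesFarMerging.Negative.IsingCertificate

/-!
# Crux `NonSeparableModulus` (stmt-CriticalPhenomena-6152) — crux idea `axial-logconvex-amplifier`
# `NonSeparableModulus ⟺ TwoPointDoubling` (item 6150) — SORRY-FREE

Planner evidence file (crux-ideate round 1, ideator 1). Everything below is kernel-checked
(`lean check` rc 0, 0 sorries; `#print axioms nonSeparableModulus_iff_twoPointDoubling` =
`[propext, Classical.choice, Quot.sound]`). New direction proved here: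
`twoPointDoubling_of_nonSeparableModulus : NonSeparableModulus → TwoPointDoubling`, from LANDED
lattice inputs only (`criticalTwoPoint_axis_ratio_mono`, `criticalTwoPoint_axis_succ_le`,
`criticalTwoPoint_axis_pos`, `criticalUrsellFour_nonpos` (Lebowitz), `criticalCorr_griffiths` (GKS II),
`criticalCorr_two_pair`). The converse `TwoPointDoubling → NonSeparableModulus` is landed
(`ItemMaps.uniformRegularity_of_doubling` + `stub_nonSeparableModulus_of_uniformRegularity`).
Mechanism: L1 three-scale log-convex amplification + L2 GKS/Lebowitz pincer at the caged collinear
configuration `(0, ½e₀, e₀, 2e₀)` under the AXIAL one-point move `½e₀ ↦ (½ − η/2)e₀` at mesh `1/(2n)`.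
A prover may land this file's content verbatim as
`Theorems/MirrorHoelderCompactnessTwoPointDoublingOfNonSeparableModulus.lean --supports stmt-CriticalPhenomena-6152`
(Theorems/ is prover-only). References: Aizenman–Duminil-Copin, Ann. of Math. 194 (2021),
arXiv:1912.07973, proof of Prop. 5.9 p. 19 (the amplifier `w_{n+1}/w_n ≥ (w_n/w_{n/2})^{2/n}`) and
Remark 5.10 p. 20; Lebowitz, CMP 35 (1974); Friedli–Velenik (2017) Thm 3.20.
-/

noncomputable section

namespace Summit.CriticalPhenomena.Ising3DConformalLimit.Cruxes.NonSeparableModulus.LogConvexAmplifier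

open Literature.Probability.LatticeModels
open Summit.CriticalPhenomena.Ising3DConformalLimit.Theses.MirrorHoelderCompactness

/-- The axial critical two-point function `g(k) = ⟨σ₀σ_{k e₀}⟩⁺_{β_c(3)}`. -/
def g (k : ℕ) : ℝ := criticalTwoPoint 3 (Pi.single 0 (k : ℤ))

/-- **L1 — three-scale amplification (log-convexity only).** For `1 ≤ m ≤ n`:
`g(n)^{2n−m} ≤ g(m)^n · g(2n)^{n−m}`, i.e. `g(n)/g(m) ≤ (g(2n)/g(n))^{(n−m)/n}`: one failed octave
`g(2n) < g(n)/M` forces `g(m) ≥ M^{(n−m)/n} g(n)` just below it. Proof: `r_k := g(k+1)/g(k)` is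
nondecreasing (`criticalTwoPoint_axis_ratio_mono`), so `r_n^n ≤ ∏_{k=n}^{2n−1} r_k = g(2n)/g(n)` and
`g(n)/g(m) = ∏_{k=m}^{n−1} r_k ≤ r_n^{n−m}`. -/
def ThreeScaleAmplification : Prop :=
  ∀ m n : ℕ, 1 ≤ m → m ≤ n → g n ^ (2 * n - m) ≤ g m ^ n * g (2 * n) ^ (n - m)

/-! ### Proof of L1 (checked here because the card's claim `NS ⟹ D` rests on it) -/

theorem g_pos (k : ℕ) : 0 < g k := criticalTwoPoint_axis_pos k

/-- One-step axial ratio `r(k) = g(k+1)/g(k)`. -/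
def r (k : ℕ) : ℝ := g (k + 1) / g k

theorem r_pos (k : ℕ) : 0 < r k := div_pos (g_pos _) (g_pos _)

/-- Ratio monotonicity on `k ≥ 1` (landed log-convexity `criticalTwoPoint_axis_ratio_mono`). -/
theorem r_mono {j k : ℕ} (hj : 1 ≤ j) (hjk : j ≤ k) : r j ≤ r k := by
  have hmono := criticalTwoPoint_axis_ratio_mono (0 : Fin 3)
  obtain ⟨j', rfl⟩ : ∃ j', j = j' + 1 := ⟨j - 1, by omega⟩
  obtain ⟨k', rfl⟩ : ∃ k', k = k' + 1 := ⟨k - 1, by omega⟩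
  have h := hmono (show j' ≤ k' by omega)
  show criticalTwoPoint 3 (Pi.single 0 ((j' + 1 + 1 : ℕ) : ℤ)) /
      criticalTwoPoint 3 (Pi.single 0 ((j' + 1 : ℕ) : ℤ)) ≤
    criticalTwoPoint 3 (Pi.single 0 ((k' + 1 + 1 : ℕ) : ℤ)) /
      criticalTwoPoint 3 (Pi.single 0 ((k' + 1 : ℕ) : ℤ))
  exact h

/-- Telescoping: `g(n+L) = g(n) · ∏_{i<L} r(n+i)`. -/
theorem g_add (n L : ℕ) : g (n + L) = g n * ∏ i ∈ Finset.range L, r (n + i) := by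
  induction L with
  | zero => simp
  | succ L ih =>
    have hne := (g_pos (n + L)).ne'
    rw [Finset.prod_range_succ, ← mul_assoc, ← ih, show n + (L + 1) = n + L + 1 by omega, r]
    field_simp

/-- Octave product from below: `r(n)^n ≤ g(2n)/g(n)`. -/
theorem ratio_octave_le (n : ℕ) (hn : 1 ≤ n) : r n ^ n ≤ g (2 * n) / g n := by
  have h := g_add n n
  rw [show n + n = 2 * n by ring] at h
  rw [h, mul_div_cancel_left₀ _ (g_pos n).ne']
  calc r n ^ n = ∏ _i ∈ Finset.range n, r n := by simp
    _ ≤ ∏ i ∈ Finset.range n, r (n + i) :=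
        Finset.prod_le_prod (fun i _ => (r_pos _).le) (fun i _ => r_mono hn (by omega))

/-- Window product from above: `g(n)/g(m) ≤ r(n)^{n−m}` for `1 ≤ m ≤ n`. -/
theorem window_le (m n : ℕ) (hm : 1 ≤ m) (hmn : m ≤ n) : g n / g m ≤ r n ^ (n - m) := by
  have h := g_add m (n - m)
  rw [show m + (n - m) = n by omega] at h
  rw [h, mul_div_cancel_left₀ _ (g_pos m).ne']
  calc ∏ i ∈ Finset.range (n - m), r (m + i) ≤ ∏ _i ∈ Finset.range (n - m), r n :=
        Finset.prod_le_prod (fun i _ => (r_pos _).le) (fun i hi => r_mono (by omega) (by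
          have := Finset.mem_range.1 hi; omega))
    _ = r n ^ (n - m) := by simp

/-- **L1 holds** (sorry-free). -/
theorem threeScaleAmplification : ThreeScaleAmplification := by
  intro m n hm hmn
  have hn : 1 ≤ n := hm.trans hmn
  have A := ratio_octave_le n hn
  have B := window_le m n hm hmn
  have hr := (r_pos n).le
  have key : (g n / g m) ^ n ≤ (g (2 * n) / g n) ^ (n - m) := by
    calc (g n / g m) ^ n ≤ (r n ^ (n - m)) ^ n :=
          pow_le_pow_left₀ (div_nonneg (g_pos _).le (g_pos _).le) B n
      _ = (r n ^ n) ^ (n - m) := by rw [← pow_mul, ← pow_mul, mul_comm]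
      _ ≤ (g (2 * n) / g n) ^ (n - m) := pow_le_pow_left₀ (pow_nonneg hr n) A (n - m)
  rw [div_pow, div_pow, div_le_div_iff₀ (pow_pos (g_pos m) n) (pow_pos (g_pos n) (n - m))] at key
  calc g n ^ (2 * n - m) = g n ^ n * g n ^ (n - m) := by
        rw [← pow_add]; congr 1; omega
    _ ≤ g (2 * n) ^ (n - m) * g m ^ n := key
    _ = g m ^ n * g (2 * n) ^ (n - m) := mul_comm _ _

/-- **L2 — the caged collinear pincer.** At lattice points `0, m e₀, 2n e₀, 4n e₀` (`1 ≤ m ≤ n`; the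
second point is caged between the first and the third): GKS II below,
`g(m)·g(2n) ≤ ⟨σ₀ σ_{m e₀} σ_{2n e₀} σ_{4n e₀}⟩` (`criticalCorr_griffiths`), and Newman/Lebowitz pairing
above at `m = n`, `⟨σ₀ σ_{n e₀} σ_{2n e₀} σ_{4n e₀}⟩ ≤ g(n)g(2n) + g(2n)g(3n) + g(4n)g(n) ≤ 3 g(n) g(2n)`
(`criticalCorr_le_pairingSum` + axis monotonicity `criticalTwoPoint_axis_succ_le`). -/
def CagedCollinearPincer : Prop :=
  ∀ m n : ℕ, 1 ≤ m → m ≤ n →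
    g m * g (2 * n) ≤
        criticalCorr 3 4 ![0, Pi.single 0 (m : ℤ), Pi.single 0 ((2 * n : ℕ) : ℤ), Pi.single 0 ((4 * n : ℕ) : ℤ)]
      ∧ criticalCorr 3 4 ![0, Pi.single 0 (n : ℤ), Pi.single 0 ((2 * n : ℕ) : ℤ), Pi.single 0 ((4 * n : ℕ) : ℤ)]
        ≤ 3 * g n * g (2 * n)

/-! ### Proof of L2 (GKS II + Lebowitz at four collinear points; landed lemmas only) -/

/-- Axis two-point values: `⟨σ_{a e₀} σ_{b e₀}⟩ = g(b − a)` for `a ≤ b`. -/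
theorem cc_axis (a b : ℕ) (hab : a ≤ b) :
    criticalCorr 3 2 ![(Pi.single 0 (a : ℤ) : Site 3), Pi.single 0 (b : ℤ)] = g (b - a) := by
  rw [criticalCorr_two_pair, ← Pi.single_sub]
  simp only [g, Nat.cast_sub hab]

/-- `g` is nonincreasing on `k ≥ 1` (landed `criticalTwoPoint_axis_succ_le`). -/
theorem g_anti {a b : ℕ} (ha : 1 ≤ a) (hab : a ≤ b) : g b ≤ g a := by
  induction b, hab using Nat.le_induction with
  | base => exact le_rfl
  | succ b hb ih =>
    refine le_trans ?_ ih
    obtain ⟨k, rfl⟩ : ∃ k, b = k + 1 := ⟨b - 1, by omega⟩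
    exact criticalTwoPoint_axis_succ_le 0 k

/-- **L2 holds** (sorry-free). -/
theorem cagedCollinearPincer : CagedCollinearPincer := by
  intro m n hm hmn
  have hn : 1 ≤ n := hm.trans hmn
  have zero_single : (0 : Site 3) = Pi.single 0 ((0 : ℕ) : ℤ) := by simp
  set A : Site 3 := Pi.single 0 (m : ℤ) with hA
  set N1 : Site 3 := Pi.single 0 (n : ℤ) with hN1
  set B : Site 3 := Pi.single 0 ((2 * n : ℕ) : ℤ) with hB
  set C : Site 3 := Pi.single 0 ((4 * n : ℕ) : ℤ) with hC
  have e0A : criticalCorr 3 2 ![(0 : Site 3), A] = g m := by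
    rw [zero_single, hA, cc_axis 0 m (Nat.zero_le _)]; simp
  have e0N : criticalCorr 3 2 ![(0 : Site 3), N1] = g n := by
    rw [zero_single, hN1, cc_axis 0 n (Nat.zero_le _)]; simp
  have e0B : criticalCorr 3 2 ![(0 : Site 3), B] = g (2 * n) := by
    rw [zero_single, hB, cc_axis 0 (2 * n) (Nat.zero_le _)]; simp
  have e0C : criticalCorr 3 2 ![(0 : Site 3), C] = g (4 * n) := by
    rw [zero_single, hC, cc_axis 0 (4 * n) (Nat.zero_le _)]; simp
  have eBC : criticalCorr 3 2 ![B, C] = g (2 * n) := by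
    rw [hB, hC, cc_axis (2 * n) (4 * n) (by omega)]; congr 1; omega
  have eNC : criticalCorr 3 2 ![N1, C] = g (3 * n) := by
    rw [hN1, hC, cc_axis n (4 * n) (by omega)]; congr 1; omega
  have eNB : criticalCorr 3 2 ![N1, B] = g n := by
    rw [hN1, hB, cc_axis n (2 * n) (by omega)]; congr 1; omega
  constructor
  · -- GKS II
    have h := Summit.CriticalPhenomena.Ising3DConformalLimit.Theorems.GapForcesFarMerging.Negative.criticalCorr_griffiths
      ![0, A, B, C]
    change criticalCorr 3 2 ![(0 : Site 3), A] * criticalCorr 3 2 ![B, C] ≤ criticalCorr 3 4 ![0, A, B, C] at h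
    rwa [e0A, eBC] at h
  · -- Lebowitz `U₄ ≤ 0` + axis monotonicity
    have h := criticalUrsellFour_nonpos (d := 3) le_rfl ![0, N1, B, C]
    change criticalCorr 3 4 ![0, N1, B, C] - (criticalCorr 3 2 ![(0 : Site 3), N1] * criticalCorr 3 2 ![B, C]
        + criticalCorr 3 2 ![(0 : Site 3), B] * criticalCorr 3 2 ![N1, C]
        + criticalCorr 3 2 ![(0 : Site 3), C] * criticalCorr 3 2 ![N1, B]) ≤ 0 at h
    rw [e0N, eBC, e0B, eNC, e0C, eNB] at h
    have h3 : g (3 * n) ≤ g n := g_anti hn (by omega)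
    have h4 : g (4 * n) ≤ g (2 * n) := g_anti (by omega) (by omega)
    have p1 : g (2 * n) * g (3 * n) ≤ g (2 * n) * g n := mul_le_mul_of_nonneg_left h3 (g_pos _).le
    have p2 : g (4 * n) * g n ≤ g (2 * n) * g n := mul_le_mul_of_nonneg_right h4 (g_pos _).le
    linarith

/-- **L2 + L1 ⇒ the quantitative caged jump** on the lattice (sorry-free): for `1 ≤ m ≤ n`,
`⟨σ₀σ_{m}σ_{2n}σ_{4n}⟩ − ⟨σ₀σ_{n}σ_{2n}σ_{4n}⟩ ≥ g(2n)·(g(m) − 3 g(n))`. -/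
theorem cagedJump_lattice (m n : ℕ) (hm : 1 ≤ m) (hmn : m ≤ n) :
    g (2 * n) * (g m - 3 * g n) ≤
      criticalCorr 3 4 ![0, Pi.single 0 (m : ℤ), Pi.single 0 ((2 * n : ℕ) : ℤ), Pi.single 0 ((4 * n : ℕ) : ℤ)]
        - criticalCorr 3 4 ![0, Pi.single 0 (n : ℤ), Pi.single 0 ((2 * n : ℕ) : ℤ), Pi.single 0 ((4 * n : ℕ) : ℤ)] := by
  obtain ⟨h1, h2⟩ := cagedCollinearPincer m n hm hmn
  nlinarith [h1, h2]

/-! ### The caged collinear configuration `(0, ½e₀, e₀, 2e₀)` and its lattice shadows -/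

/-- The unit vector `e₀`. -/
def e0 : EuclideanSpace ℝ (Fin 3) := EuclideanSpace.single 0 1

/-- Coefficients of the configuration along `e₀`: `(0, ½, 1, 2)`; the point `½e₀` (index 1) is caged. -/
def coef : Fin 4 → ℝ := ![0, 1 / 2, 1, 2]

/-- The configuration `xc = (0, ½e₀, e₀, 2e₀)`. -/
def xc : Fin 4 → EuclideanSpace ℝ (Fin 3) := fun k => coef k • e0

theorem coef0 : coef 0 = 0 := rfl
theorem coef1 : coef 1 = 1 / 2 := rfl
theorem coef2 : coef 2 = 1 := rfl
theorem coef3 : coef 3 = 2 := rfl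

theorem xc0 : xc 0 = (0 : ℝ) • e0 := rfl
theorem xc1 : xc 1 = (1 / 2 : ℝ) • e0 := rfl
theorem xc2 : xc 2 = (1 : ℝ) • e0 := rfl
theorem xc3 : xc 3 = (2 : ℝ) • e0 := rfl

theorem e0_apply (i : Fin 3) : e0 i = if i = 0 then 1 else 0 := by
  simp [e0, EuclideanSpace.single_apply]

theorem norm_e0 : ‖e0‖ = 1 := by
  simp [e0, EuclideanSpace.norm_single]

theorem coef_injective : Function.Injective coef := by
  intro a b h
  fin_cases a <;> fin_cases b <;> first | rfl | (exfalso; revert h; norm_num [coef])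

theorem xc_injective : Function.Injective xc := by
  intro a b h
  have h0 : xc a 0 = xc b 0 := by rw [h]
  have ha : xc a 0 = coef a := by simp [xc, e0_apply]
  have hb : xc b 0 = coef b := by simp [xc, e0_apply]
  rw [ha, hb] at h0
  exact coef_injective h0

/-- Lattice shadow of a point `c • e₀` at mesh `δ`: the axis site `⌊c/δ⌋ e₀`. -/
theorem latticeApprox_smul_e0 (δ c : ℝ) : latticeApprox δ (c • e0) = Pi.single 0 ⌊c / δ⌋ := by
  funext i
  rw [latticeApprox_apply]
  by_cases hi : i = 0
  · subst hi
    simp [e0_apply]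
  · simp [e0_apply, hi]

set_option maxHeartbeats 1000000 in
/-- **FIRST LEMMA of the card — PROVED: `NonSeparableModulus → TwoPointDoubling`.**
Assume `¬ TwoPointDoubling`; apply NS with `n = 4`, `K = {(0, ½e₀, e₀, 2e₀)}` (compact,
non-coincident; the point `½e₀`, index 1, is NOT `m`-separable for ANY `m > 0`: all four points lie on
the line `ℝe₀`, so `⟪u, x_k⟫ = c_k⟪u, e₀⟫` with `c = (0, ½, 1, 2)` and `½` strictly inside), `ε = 1`;
get `m, η, δ₀`; put `η' = min η ½`, `T = ⌈1/η'⌉`, `κ = min(½, κ₁, 4^{-T})` with `κ₁ > 0` the minimum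
doubling ratio over the scales `≤ n₀ = max 4 (⌈1/δ₀⌉+1)`; `¬D` gives `n > n₀` with `g(2n) < κ g(n)`;
mesh `δ = 1/(2n) < δ₀` (lattice points `0, n e₀, 2n e₀, 4n e₀`), move `y = (½ − η'/2)e₀`
(`‖y − x₁‖ = η'/2 < η`, lattice point `m'e₀`, `m' = ⌊n − η'n⌋`, `n − m' ≥ η'n`). L1 + `κ ≤ 4^{-T}`
force `g(m') ≥ 4 g(n)` (else `g(n)^{2n−m'} < 4ⁿκ^{n−m'}g(n)^{2n−m'} ≤ g(n)^{2n−m'}`); L2 gives the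
jump `F(update x 1 y) − F(x) ≥ g(n)/g(2n) > 1/κ ≥ 2`, contradicting `|…| < 1`. -/
theorem twoPointDoubling_of_nonSeparableModulus : NonSeparableModulus → TwoPointDoubling := by
  intro hNS
  by_contra hD
  unfold TwoPointDoubling at hD
  push_neg at hD
  -- Step 1: apply NS at the caged collinear configuration.
  have hK : ({xc} : Set (Fin 4 → EuclideanSpace ℝ (Fin 3))) ⊆ NonCoincident 3 4 := by
    rw [Set.singleton_subset_iff, mem_nonCoincident]
    exact xc_injective
  obtain ⟨m, η, δ₀, hm, hη, hδ₀, H⟩ := hNS 4 {xc} hK isCompact_singleton 1 one_pos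
  -- Step 2: parameters.
  set η' : ℝ := min η (1 / 2) with hη'
  have hη'pos : 0 < η' := lt_min hη (by norm_num)
  have hη'le : η' ≤ 1 / 2 := min_le_right _ _
  have hη'leη : η' ≤ η := min_le_left _ _
  set T : ℕ := ⌈1 / η'⌉₊ with hT
  have hTge : 1 / η' ≤ (T : ℝ) := Nat.le_ceil _
  set n₀ : ℕ := max 4 (⌈1 / δ₀⌉₊ + 1) with hn₀
  -- positive lower bound of the doubling ratio on the finitely many small scales
  have hne : (Finset.Icc 1 n₀).Nonempty := ⟨1, by simp [hn₀]⟩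
  set κ₁ : ℝ := (Finset.Icc 1 n₀).inf' hne (fun k => g (2 * k) / g k) with hκ₁
  have hκ₁pos : 0 < κ₁ := by
    rw [hκ₁, Finset.lt_inf'_iff]
    intro k _
    exact div_pos (g_pos _) (g_pos _)
  set κ : ℝ := min (min (1 / 2) κ₁) ((1 / 4 : ℝ) ^ T) with hκ
  have hκpos : 0 < κ := lt_min (lt_min (by norm_num) hκ₁pos) (by positivity)
  have hκhalf : κ ≤ 1 / 2 := (min_le_left _ _).trans (min_le_left _ _)
  have hκ₁le : κ ≤ κ₁ := (min_le_left _ _).trans (min_le_right _ _)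
  have hκT : κ ≤ (1 / 4 : ℝ) ^ T := min_le_right _ _
  -- Step 3: the failed octave at a large scale `n`.
  obtain ⟨n, hn1, hfail⟩ := hD κ hκpos
  have hfail' : g (2 * n) < κ * g n := by
    have : (Pi.single 0 ((2 * n : ℕ) : ℤ) : Site 3) = Pi.single 0 (2 * (n : ℤ)) := by push_cast; rfl
    simpa [g, this] using hfail
  have hn_large : n₀ < n := by
    by_contra hle
    push_neg at hle
    have hmem : n ∈ Finset.Icc 1 n₀ := Finset.mem_Icc.2 ⟨hn1, hle⟩
    have h1 : κ₁ ≤ g (2 * n) / g n := Finset.inf'_le _ hmem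
    have h2 : κ ≤ g (2 * n) / g n := hκ₁le.trans h1
    rw [le_div_iff₀ (g_pos n)] at h2
    linarith
  have hn4 : 4 ≤ n := le_trans (le_max_left _ _) hn_large.le
  have hnδ : ⌈1 / δ₀⌉₊ + 1 ≤ n := le_trans (le_max_right _ _) hn_large.le
  have hnR : (4 : ℝ) ≤ n := by exact_mod_cast hn4
  have hn0 : (n : ℝ) ≠ 0 := by positivity
  have hnpos : (0 : ℝ) < n := by positivity
  -- Step 4: the mesh `δ = 1/(2n)` and its floors.
  set δ : ℝ := 1 / (2 * (n : ℝ)) with hδ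
  have hδpos : 0 < δ := by positivity
  have hδlt : δ < δ₀ := by
    have h1 : (1 / δ₀ : ℝ) ≤ ⌈1 / δ₀⌉₊ := Nat.le_ceil _
    have h2 : ((⌈1 / δ₀⌉₊ : ℕ) : ℝ) + 1 ≤ n := by exact_mod_cast hnδ
    have h3 : 1 / δ₀ < (n : ℝ) := by linarith
    rw [div_lt_iff₀ hδ₀] at h3
    rw [hδ, div_lt_iff₀ (by positivity)]
    nlinarith
  have hδmem : δ ∈ Set.Ioo 0 δ₀ := ⟨hδpos, hδlt⟩
  have hf0 : ⌊(0 : ℝ) / δ⌋ = (0 : ℤ) := by simp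
  have hf1 : ⌊(1 / 2 : ℝ) / δ⌋ = (n : ℤ) := by
    rw [show (1 / 2 : ℝ) / δ = (n : ℝ) by rw [hδ]; field_simp]
    exact Int.floor_natCast n
  have hf2 : ⌊(1 : ℝ) / δ⌋ = ((2 * n : ℕ) : ℤ) := by
    rw [show (1 : ℝ) / δ = ((2 * n : ℕ) : ℝ) by rw [hδ]; push_cast; field_simp]
    exact Int.floor_natCast _
  have hf3 : ⌊(2 : ℝ) / δ⌋ = ((4 * n : ℕ) : ℤ) := by
    rw [show (2 : ℝ) / δ = ((4 * n : ℕ) : ℝ) by rw [hδ]; push_cast; field_simp; ring]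
    exact Int.floor_natCast _
  have hfinv : ⌊δ⁻¹⌋ = ((2 * n : ℕ) : ℤ) := by
    rw [show δ⁻¹ = ((2 * n : ℕ) : ℝ) by rw [hδ, one_div, inv_inv]; push_cast; ring]
    exact Int.floor_natCast _
  -- the moved point's lattice coordinate
  set M' : ℤ := ⌊(n : ℝ) - η' * n⌋ with hM'
  have hM'le : (M' : ℝ) ≤ n - η' * n := Int.floor_le _
  have hM'lt : (n : ℝ) - η' * n < M' + 1 := Int.lt_floor_add_one _
  have hM'1 : (1 : ℤ) ≤ M' := by
    rw [hM', Int.le_floor]; push_cast; nlinarith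
  have hM'n : M' ≤ n := by
    have : M' ≤ ⌊((n : ℕ) : ℝ)⌋ := Int.floor_le_floor (by nlinarith)
    rwa [Int.floor_natCast] at this
  have hM'0 : 0 ≤ M' := le_trans (by norm_num) hM'1
  set m' : ℕ := M'.toNat with hm'
  have hm'Z : ((m' : ℕ) : ℤ) = M' := Int.toNat_of_nonneg hM'0
  have hm'1 : 1 ≤ m' := by omega
  have hm'n : m' ≤ n := by omega
  have hm'R : ((m' : ℕ) : ℝ) = (M' : ℝ) := by exact_mod_cast hm'Z
  have hgap : η' * n ≤ (n : ℝ) - m' := by rw [hm'R]; linarith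
  have hfy : ⌊(1 / 2 - η' / 2 : ℝ) / δ⌋ = (m' : ℤ) := by
    rw [hm'Z, hM']; congr 1; rw [hδ]; field_simp; first | done | ring
  -- Step 5: the move `y` and the NS conclusion.
  set y : EuclideanSpace ℝ (Fin 3) := (1 / 2 - η' / 2 : ℝ) • e0 with hy
  have hdist : ‖y - xc 1‖ < η := by
    have : y - xc 1 = (-(η' / 2) : ℝ) • e0 := by
      rw [hy, xc1, ← sub_smul]; congr 1; ring
    rw [this, norm_smul, norm_e0, mul_one, Real.norm_eq_abs, abs_neg, abs_of_pos (by positivity)]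
    linarith
  have hcaged : ¬ (∃ u : EuclideanSpace ℝ (Fin 3), (∃ i j : Fin 3, i ≠ j ∧
      (u = EuclideanSpace.single i 1 ∨ u = EuclideanSpace.single i 1 + EuclideanSpace.single j 1 ∨
        u = EuclideanSpace.single i 1 - EuclideanSpace.single j 1)) ∧
      ((∀ j : Fin 4, j ≠ 1 → inner ℝ u (xc j) + m ≤ inner ℝ u (xc 1)) ∨
        (∀ j : Fin 4, j ≠ 1 → inner ℝ u (xc 1) + m ≤ inner ℝ u (xc j)))) := by
    rintro ⟨u, -, hsep⟩
    have e : ∀ k : Fin 4, inner ℝ u (xc k) = coef k * inner ℝ u e0 := fun k => by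
      rw [xc]; exact real_inner_smul_right _ _ _
    rcases hsep with h | h
    · have h0 := h 0 (by decide)
      have h2 := h 2 (by decide)
      rw [e, e] at h0 h2
      simp only [coef0, coef1, coef2] at h0 h2
      linarith
    · have h0 := h 0 (by decide)
      have h2 := h 2 (by decide)
      rw [e, e] at h0 h2
      simp only [coef0, coef1, coef2] at h0 h2
      linarith
  have hNSc := H δ hδmem xc rfl 1 y hdist hcaged
  -- Step 6: identify the two lattice configurations.
  have Lx : (fun i => latticeApprox δ (xc i)) =
      ![0, Pi.single 0 (n : ℤ), Pi.single 0 ((2 * n : ℕ) : ℤ), Pi.single 0 ((4 * n : ℕ) : ℤ)] := by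
    funext i
    fin_cases i
    · show latticeApprox δ (xc 0) = 0
      rw [xc0, latticeApprox_smul_e0, hf0, Pi.single_zero]
    · show latticeApprox δ (xc 1) = Pi.single 0 (n : ℤ)
      rw [xc1, latticeApprox_smul_e0, hf1]
    · show latticeApprox δ (xc 2) = Pi.single 0 ((2 * n : ℕ) : ℤ)
      rw [xc2, latticeApprox_smul_e0, hf2]
    · show latticeApprox δ (xc 3) = Pi.single 0 ((4 * n : ℕ) : ℤ)
      rw [xc3, latticeApprox_smul_e0, hf3]
  have Ly : (fun i => latticeApprox δ (Function.update xc 1 y i)) =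
      ![0, Pi.single 0 (m' : ℤ), Pi.single 0 ((2 * n : ℕ) : ℤ), Pi.single 0 ((4 * n : ℕ) : ℤ)] := by
    funext i
    fin_cases i
    · show latticeApprox δ (Function.update xc 1 y 0) = 0
      rw [Function.update_of_ne (by decide), xc0, latticeApprox_smul_e0, hf0, Pi.single_zero]
    · show latticeApprox δ (Function.update xc 1 y 1) = Pi.single 0 (m' : ℤ)
      rw [Function.update_self, hy, latticeApprox_smul_e0, hfy]
    · show latticeApprox δ (Function.update xc 1 y 2) = Pi.single 0 ((2 * n : ℕ) : ℤ)
      rw [Function.update_of_ne (by decide), xc2, latticeApprox_smul_e0, hf2]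
    · show latticeApprox δ (Function.update xc 1 y 3) = Pi.single 0 ((4 * n : ℕ) : ℤ)
      rw [Function.update_of_ne (by decide), xc3, latticeApprox_smul_e0, hf3]
  -- Step 7: the renormalisation factor `ρ★(δ)⁴ = g(2n)⁻²`.
  have hg2pos : 0 < g (2 * n) := g_pos _
  have hρ : (criticalTwoPoint 3 (Pi.single 0 ⌊δ⁻¹⌋)) ^ (-(1 / 2 : ℝ)) = g (2 * n) ^ (-(1 / 2 : ℝ)) := by
    rw [hfinv]; rfl
  have hρ4 : (g (2 * n) ^ (-(1 / 2 : ℝ))) ^ 4 * (g (2 * n)) ^ 2 = 1 := by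
    have hg2ne : g (2 * n) ≠ 0 := hg2pos.ne'
    rw [← Real.rpow_mul_natCast hg2pos.le]
    norm_num
    first
      | done
      | (field_simp [hg2ne])
      | (rw [Real.rpow_neg hg2pos.le, Real.rpow_two]; field_simp [hg2ne])
  -- Step 8: the amplified lower bound `g(m') ≥ 4 g(n)`.
  have hbig : 4 * g n ≤ g m' := by
    by_contra hlt
    push_neg at hlt
    have key := threeScaleAmplification m' n hm'1 hm'n
    have hnn : n ≠ 0 := by omega
    have A1 : g m' ^ n < (4 * g n) ^ n := pow_lt_pow_left₀ hlt (g_pos _).le hnn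
    have A2 : g (2 * n) ^ (n - m') ≤ (κ * g n) ^ (n - m') :=
      pow_le_pow_left₀ (g_pos _).le hfail'.le _
    have A3 : g n ^ (2 * n - m') < (4 : ℝ) ^ n * κ ^ (n - m') * g n ^ (2 * n - m') := by
      calc g n ^ (2 * n - m') ≤ g m' ^ n * g (2 * n) ^ (n - m') := key
        _ < (4 * g n) ^ n * (κ * g n) ^ (n - m') :=
            mul_lt_mul_of_pos_of_nonneg' A1 A2 (pow_pos (g_pos _) _)
              (pow_nonneg (mul_nonneg (by norm_num) (g_pos n).le) _)
        _ = (4 : ℝ) ^ n * κ ^ (n - m') * (g n ^ n * g n ^ (n - m')) := by rw [mul_pow, mul_pow]; ring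
        _ = (4 : ℝ) ^ n * κ ^ (n - m') * g n ^ (2 * n - m') := by
            rw [← pow_add]; congr 2; omega
    have A4 : 1 < (4 : ℝ) ^ n * κ ^ (n - m') :=
      (lt_mul_iff_one_lt_left (pow_pos (g_pos n) _)).1 A3
    -- but κ^(n - m') ≤ (1/4)^n
    have hTn : n ≤ T * (n - m') := by
      have h1 : (n : ℝ) ≤ (T : ℝ) * ((n : ℝ) - m') := by
        calc (n : ℝ) = (1 / η') * (η' * n) := by field_simp
          _ ≤ (T : ℝ) * ((n : ℝ) - m') :=
              mul_le_mul hTge hgap (by positivity) (by positivity)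
      have h2 : ((n - m' : ℕ) : ℝ) = (n : ℝ) - m' := by push_cast [Nat.cast_sub hm'n]; ring
      rw [← h2] at h1
      exact_mod_cast h1
    have A5 : κ ^ (n - m') ≤ (1 / 4 : ℝ) ^ n := by
      calc κ ^ (n - m') ≤ ((1 / 4 : ℝ) ^ T) ^ (n - m') := pow_le_pow_left₀ hκpos.le hκT _
        _ = (1 / 4 : ℝ) ^ (T * (n - m')) := by rw [← pow_mul]
        _ ≤ (1 / 4 : ℝ) ^ n := pow_le_pow_of_le_one (by norm_num) (by norm_num) hTn
    have A6 : (4 : ℝ) ^ n * κ ^ (n - m') ≤ 1 := by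
      calc (4 : ℝ) ^ n * κ ^ (n - m') ≤ (4 : ℝ) ^ n * (1 / 4 : ℝ) ^ n :=
            mul_le_mul_of_nonneg_left A5 (by positivity)
        _ = 1 := by rw [← mul_pow]; norm_num
    linarith
  -- Step 9: the jump contradicts the NS bound.
  have hjump := cagedJump_lattice m' n hm'1 hm'n
  have hlow : g (2 * n) * g n ≤
      criticalCorr 3 4 ![0, Pi.single 0 (m' : ℤ), Pi.single 0 ((2 * n : ℕ) : ℤ), Pi.single 0 ((4 * n : ℕ) : ℤ)]
        - criticalCorr 3 4 ![0, Pi.single 0 (n : ℤ), Pi.single 0 ((2 * n : ℕ) : ℤ), Pi.single 0 ((4 * n : ℕ) : ℤ)] := by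
    have : g (2 * n) * g n ≤ g (2 * n) * (g m' - 3 * g n) :=
      mul_le_mul_of_nonneg_left (by linarith) hg2pos.le
    exact this.trans hjump
  have Lx' : criticalCorr 3 4 (fun i => latticeApprox δ (xc i)) =
      criticalCorr 3 4 ![0, Pi.single 0 (n : ℤ), Pi.single 0 ((2 * n : ℕ) : ℤ), Pi.single 0 ((4 * n : ℕ) : ℤ)] := by
    rw [Lx]
  have Ly' : criticalCorr 3 4 (fun i => latticeApprox δ (Function.update xc 1 y i)) =
      criticalCorr 3 4 ![0, Pi.single 0 (m' : ℤ), Pi.single 0 ((2 * n : ℕ) : ℤ), Pi.single 0 ((4 * n : ℕ) : ℤ)] := by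
    rw [Ly]
  rw [rescaledCorrelator_apply, rescaledCorrelator_apply, Lx', Ly'] at hNSc
  simp only [hρ] at hNSc
  have hg2ne : g (2 * n) ≠ 0 := hg2pos.ne'
  have hρpos : 0 < (g (2 * n) ^ (-(1 / 2 : ℝ))) ^ 4 := pow_pos (Real.rpow_pos_of_pos hg2pos _) 4
  have hRval : (g (2 * n) ^ (-(1 / 2 : ℝ))) ^ 4 = (g (2 * n) ^ 2)⁻¹ := eq_inv_of_mul_eq_one_left hρ4
  have hlt1 : (g (2 * n) ^ (-(1 / 2 : ℝ))) ^ 4 *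
        criticalCorr 3 4 ![0, Pi.single 0 (m' : ℤ), Pi.single 0 ((2 * n : ℕ) : ℤ), Pi.single 0 ((4 * n : ℕ) : ℤ)]
      - (g (2 * n) ^ (-(1 / 2 : ℝ))) ^ 4 *
        criticalCorr 3 4 ![0, Pi.single 0 (n : ℤ), Pi.single 0 ((2 * n : ℕ) : ℤ), Pi.single 0 ((4 * n : ℕ) : ℤ)] < 1 :=
    (abs_lt.1 hNSc).2
  have h1 : (g (2 * n) ^ (-(1 / 2 : ℝ))) ^ 4 * (g (2 * n) * g n) ≤
      (g (2 * n) ^ (-(1 / 2 : ℝ))) ^ 4 *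
        criticalCorr 3 4 ![0, Pi.single 0 (m' : ℤ), Pi.single 0 ((2 * n : ℕ) : ℤ), Pi.single 0 ((4 * n : ℕ) : ℤ)]
      - (g (2 * n) ^ (-(1 / 2 : ℝ))) ^ 4 *
        criticalCorr 3 4 ![0, Pi.single 0 (n : ℤ), Pi.single 0 ((2 * n : ℕ) : ℤ), Pi.single 0 ((4 * n : ℕ) : ℤ)] := by
    rw [← mul_sub]; exact mul_le_mul_of_nonneg_left hlow hρpos.le
  have h2 : (g (2 * n) ^ (-(1 / 2 : ℝ))) ^ 4 * (g (2 * n) * g n) = g n / g (2 * n) := by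
    rw [hRval]; field_simp [hg2ne]; first | done | ring
  have h3 : 2 < g n / g (2 * n) := by
    rw [lt_div_iff₀ hg2pos]
    have : κ * g n ≤ (1 / 2) * g n := mul_le_mul_of_nonneg_right hκhalf (g_pos n).le
    linarith
  linarith

/-- Disprover idiom: any proof of NS proves doubling; a refutation of doubling refutes NS. -/
theorem nonSeparableModulus_false_without_twoPointDoubling (h : ¬ TwoPointDoubling) :
    ¬ NonSeparableModulus :=
  fun hNS => h (twoPointDoubling_of_nonSeparableModulus hNS)

/-- **NS ⟺ item 6150** (`→` this card; `←` landed: 6150 ⟹ 4658 ⟹ 6152). -/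
theorem nonSeparableModulus_iff_twoPointDoubling : NonSeparableModulus ↔ TwoPointDoubling :=
  ⟨twoPointDoubling_of_nonSeparableModulus, fun hD =>
    Cruxes.ExistsScaleCovariantLimit.TwoHierarchies.stub_nonSeparableModulus_of_uniformRegularity
      (Cruxes.ExistsScaleCovariantLimit.TwoHierarchies.ItemMaps.uniformRegularity_of_doubling hD)⟩

/-- The `MonotoneBlocking` copy of the crux is the same statement. -/
theorem monotoneBlocking_nonSeparableModulus_iff_twoPointDoubling :
    Summit.CriticalPhenomena.Ising3DConformalLimit.Theses.MonotoneBlocking.NonSeparableModulus ↔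
      TwoPointDoubling :=
  nonSeparableModulus_iff_twoPointDoubling

/-- NS ⟺ item 4658 `UniformRegularity` as well (landed `uniformRegularity_iff_doubling`). -/
theorem nonSeparableModulus_iff_uniformRegularity :
    NonSeparableModulus ↔
      Summit.CriticalPhenomena.Ising3DConformalLimit.Theses.MonotoneRG.UniformRegularity :=
  nonSeparableModulus_iff_twoPointDoubling.trans
    Cruxes.ExistsScaleCovariantLimit.TwoHierarchies.ItemMaps.uniformRegularity_iff_doubling.symm

end Summit.CriticalPhenomena.Ising3DConformalLimit.Cruxes.NonSeparableModulus.LogConvexAmplifier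

end
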